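import Literature.AnabelianGeometry.EtaleTheta.ThetaDeckConjugation
import HarnessLib

/-!
# Non-vacuity of the relation system of `ThetaDeckConjugation` WITH A LIVE TWIST (`κ = 1`)

Mochizuki, *The étale theta function …*, Publ. RIMS **45** (2009), Prop. 1.5 (iii), PRIMS PDF p. 23
[cite: MochizukiEtTh2009, Prop 1.5 (iii) p.23]: the `Z`-action clause "`η̈^Θ ↦ η̈^Θ − 2a·log(Ü) − (a²/2)·log(q_X) + log(O^×_K̈)`".

PROOF-ONLY companion (abc-iut cell, seat abc-iut-w6-d069; follow-up of the RQ7 second read of p430662, INFO-2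
«non-vacuity of the relation system with a live twist `κ ≠ 0` is not exhibited»).  abc-iut-L2-t12's
`ThetaDeckConjugation.lean` derives the closed form of the deck conjugation from four relations in an arbitrary group:
`b c = c b`, `a c = c a`, `a⁻¹ b a = c⁻¹ b` and the TWISTED Galois relation `a⁻¹ g a = b^{2κ} c^{−κ} g`.  This file
checks in the kernel that these four relations are JOINTLY SATISFIABLE with a non-trivial twist (`κ = 1`,
`b² c⁻¹ ≠ 1`): the group `ℤ³ ⋊_θ ℤ` with `θ(x, y, z) = (x + 2z, −x + y − z, z)` (conjugation by the deck generator),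
`b, c, g` the three coordinate vectors and `a` the generator of the acting `ℤ`.  So the Tate case `conj_zpow_normalForm_tate`
is an identity about a non-empty class of models, not only about the split/trivial ones.  Pure group theory; nothing of
[EtTh] is asserted; no side taken on [IUTchIII] Cor. 3.12.
-/

namespace Literature.AnabelianGeometry.EtaleTheta

namespace ThetaDeckConjugation

open Multiplicative

/-- **Live-twist model of the deck relations** (`κ = 1`): there is a group with elements `a, b, c, g` satisfying
`b c = c b`, `a c = c a`, `a⁻¹ b a = c⁻¹ b`, `a⁻¹ g a = b² c⁻¹ g` and `b² c⁻¹ ≠ 1` — namely `ℤ³ ⋊_θ ℤ`,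
`θ(x,y,z) = (x + 2z, −x + y − z, z)`.  Hence the hypotheses of `conj_zpow_normalForm_tate` with `κ = 1` are jointly
satisfiable with a non-trivial twist. [cite: MochizukiEtTh2009, Prop 1.5 (iii) p.23] -/
theorem exists_model_live_twist :
    ∃ (P : Type) (_ : Group P) (a b c g : P),
      b * c = c * b ∧ a * c = c * a ∧ a⁻¹ * b * a = c⁻¹ * b ∧
        a⁻¹ * g * a = b ^ (2 * (1 : ℤ)) * c ^ (-(1 : ℤ)) * g ∧ b ^ (2 * (1 : ℤ)) * c ^ (-(1 : ℤ)) ≠ 1 := by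
  -- the additive automorphism `θ` of `ℤ³` (conjugation by the deck generator) and its inverse
  let θ : (ℤ × ℤ × ℤ) ≃+ (ℤ × ℤ × ℤ) :=
    { toFun := fun v => (v.1 + 2 * v.2.2, -v.1 + v.2.1 - v.2.2, v.2.2)
      invFun := fun v => (v.1 - 2 * v.2.2, v.1 + v.2.1 - v.2.2, v.2.2)
      left_inv := fun v => by ext <;> simp only <;> ring
      right_inv := fun v => by ext <;> simp only <;> ring
      map_add' := fun v w => by ext <;> simp only [Prod.fst_add, Prod.snd_add] <;> ring }
  let Θ : MulAut (Multiplicative (ℤ × ℤ × ℤ)) := AddEquiv.toMultiplicative θ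
  let φ : Multiplicative ℤ →* MulAut (Multiplicative (ℤ × ℤ × ℤ)) := zpowersHom _ Θ⁻¹
  refine ⟨Multiplicative (ℤ × ℤ × ℤ) ⋊[φ] Multiplicative ℤ, inferInstance,
    SemidirectProduct.inr (ofAdd (1 : ℤ)), SemidirectProduct.inl (ofAdd ((1 : ℤ), (0 : ℤ), (0 : ℤ))),
    SemidirectProduct.inl (ofAdd ((0 : ℤ), (1 : ℤ), (0 : ℤ))),
    SemidirectProduct.inl (ofAdd ((0 : ℤ), (0 : ℤ), (1 : ℤ))), ?_, ?_, ?_, ?_, ?_⟩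
  · -- `b c = c b`
    exact SemidirectProduct.ext (by decide) (by decide)
  · -- `a c = c a`: `θ⁻¹` fixes `c`
    exact SemidirectProduct.ext (by decide) (by decide)
  · -- `a⁻¹ b a = c⁻¹ b`: `θ(b) = b - c`
    exact SemidirectProduct.ext (by decide) (by decide)
  · -- `a⁻¹ g a = b² c⁻¹ g`: `θ(g) = 2b - c + g`
    exact SemidirectProduct.ext (by decide) (by decide)
  · -- `b² c⁻¹ ≠ 1`
    intro h
    have := congrArg SemidirectProduct.left h
    revert this
    decide

end ThetaDeckConjugation

end Literature.AnabelianGeometry.EtaleTheta
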